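import Summits.HodgeConjecture.CorCM.CMSliceExhaustion
import Summits.HodgeConjecture.CorCM.Model.WeilFaceAlgebraicOfWeilLineClasses
import Summits.HodgeConjecture.CorCM.CyclotomicSliceZeta7
import Summits.HodgeConjecture.CorCM.Assembly.ModelChainClosedH1
import HarnessLib

/-!
# `HC_CM` ⟺ `W_RK4` on the model universe of record: the Hodge conjecture for CM abelian varieties IS the
# algebraicity of the rank-four face Weil lines over Galois CM fields of degree `≥ 6`

COR-CM (cell `pub-hodgecm2`), seat b24, count-neutral lane SLICE-EXHAUSTION, part 3 (theorems only, no definition, no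
named fact).  The cell's E term (`CorCM/Assembly/ModelChain.lean`, displays `ModelChainClosed{,H1}`) runs
`PerLFace ⟹ W_RK4 ⟹ ∀ Galois F, [F:ℚ] ≥ 6, ∀ Θ, U.HC (∏_j A_{(F,Θ_j)}) ⟹ HC_CM` on the Picard–CM model universe
`U = Model.universeOf hHD hI hU h₃`.  Here the middle station is shown to be EXACTLY as strong as the target:

* §1 `hodgeConjectureFor_cmProdAV_iff_universeOf_hc_cmProd` — the model's `U.HC (U.cmProd F Θ)` is the tree's
  `HodgeConjectureFor (cmProdAV F h₃ n Θ)` (the interpretation of `U.cmProd F Θ` is the underlying variety of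
  `Domination.cmProdAV F h₃ n Θ`, `Model.scheme_cmProd_universeOf`; `Model.universeOf_hc_iff_hodgeConjectureFor`);
  (the corner product `P(f)` of a face is `U.cmProd F f.corner`: `CyclotomicSlice.prod4_eq_cmProd`).
* §2 **`w_rk4_of_hc_cm`** — `HC_CM ⟹ U.W_RK4`: the Weil line `W_F(P(f))` consists of rational Hodge `(2,2)`-classes
  (`Model.universeOf_fact_weilLine_hodge`, rfwf Lemma 1.2) on the CM abelian variety `∏_i A_{(F, f.corner i)}`
  (`SliceExhaustion.isOfCMType_cmProdAV`), so `HC_CM` makes them algebraic — for EVERY instance `(hHD, hI, hU, h₃)`.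
* §3 **`hc_cm_of_w_rk4`** — `U.W_RK4 ⟹ HC_CM`: face reduction on the model (`Model.hc_cmProd_of_weilFaceAlgebraic_of_riemann`
  = Pohlmann's span theorem + [QW8] Thm 2.5, kernel modulo Riemann's theorem, which is the tree theorem
  `deligneMilne1982_Thm_6_20_full_holds`) gives every Galois slice of degree `≥ 6`, and part 1
  (`SliceExhaustion.hc_cm_of_forall_galois_cmProdAV`) exhausts `HC_CM` by those slices.
* §4 **`hc_cm_iff_w_rk4`** (every instance), **`hc_cm_iff_w_rk4_picardCMUniverse`** (the model of record
  `Model.picardCMUniverse hHD hI h₁ h₃`), **`hc_cm_iff_w_rk4_of_record`** — at the tree theorems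
  `exists_isReal_hodgeModel_holds`, `hodgePQ_independent_of_hodgeModel_holds`, `BallQuotient.ballQuotientUniformised_holds`,
  `cmAbelianVarietyRealised_holds` (the five data of the closed display F3 `hc_cm_closed_of_perLFace`):
  **`HC_CM ↔ (picardCMUniverse …holds…).W_RK4`**, no hypothesis.  So the open content of `HC_CM` is, in the kernel,
  precisely rfwf Thm 1.3 `W^{RK4}`: for every Galois CM field `F` with `[F:ℚ] ≥ 6` and every rank-four face
  `(Φ; π, π′)`, the Weil `F`-line `W_F(A_{Φ₁} × A_{Φ₂} × A_{Φ₃} × A_{Φ₄}) ⊂ H⁴` consists of algebraic classes; and the E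
  term's remaining displayed leaf `PerLFace` is a SUFFICIENT condition for it (`hc_cm_closed_of_perLFace`), recorded here
  as `w_rk4_of_record_of_perLFace`.

Nothing here asserts `HC_CM`, `W_RK4` or `PerLFace`.

## References
* [Pohlmann1968] H. Pohlmann, Ann. of Math. 88 (1968), Thm. 1 (Hodge ring of `∏ A_Φ` spanned by Hodge monomials).
* [Andre1992HodgeCM] Y. André, Progr. Math. 102 (1992), Théorème pp. 4–5 (reduction to Weil classes).
* [Milne2020HodgeClassesAV] J. S. Milne, *Hodge classes on abelian varieties* (2020), Theorem 1 and its proof.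
* [Deligne1982HodgeCycles] P. Deligne, LNM 900 (1982), §4–§5 (Weil classes are Hodge classes; CM reduction).
* [MumfordAV1970] D. Mumford, *Abelian Varieties* (1970), §19.
-/

noncomputable section

open CategoryTheory NumberField
open Literature.AlgebraicGeometry Literature.AlgebraicGeometry.Motives Literature.AlgebraicGeometry.HodgeTheory
open Literature.AlgebraicGeometry.ComplexMultiplication Literature.AlgebraicGeometry.Milne1999
open Literature.NumberTheory.Automorphic
open Literature.NumberTheory.Automorphic.PicardCM (BallQuotientUniformisedDatum CMAbelianVarietyRealised
  BallQuotientUniformised ballQuotientUniformisedDatum_of)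
open Summit.HodgeConjecture.CorCM.Domination
open Summit.HodgeConjecture.CorCM.Model

namespace Summit.HodgeConjecture.CorCM.SliceExhaustion

/-! ## §1 The model's `U.HC (U.cmProd F Θ)` is `HodgeConjectureFor (∏_j A_{(F,Θ_j)})` -/

/-- **`U.HC (U.cmProd F Θ) ⟺ HodgeConjectureFor (cmProdAV F h₃ n Θ)`** for the model universe
`U = Model.universeOf hHD hI hU h₃`: the interpretation of `U.cmProd F Θ` is the underlying variety of
`Domination.cmProdAV F h₃ n Θ` (`Model.scheme_cmProd_universeOf`), of the same dimension (`schemeDim_eq_holds`), and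
`U.HC` is the tree's `HodgeConjectureFor` on interpretations (`Model.universeOf_hc_iff_hodgeConjectureFor`).
[cite: Milne1999, §7 p. 72] -/
theorem universeOf_hc_cmProd_iff_hodgeConjectureFor_cmProdAV (hHD : exists_isReal_hodgeModel)
    (hI : hodgePQ_independent_of_hodgeModel) (hU : BallQuotientUniformisedDatum) (h₃ : CMAbelianVarietyRealised)
    (F : CMField) (n : ℕ) (Θ : Fin (n + 1) → CMType F) :
    (universeOf hHD hI hU h₃).HC ((universeOf hHD hI hU h₃).cmProd F Θ) ↔
      HodgeConjectureFor (cmProdAV F h₃ n Θ).dim (cmProdAV F h₃ n Θ).X := by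
  have hX : PicardCM.Var.scheme hU h₃ ((universeOf hHD hI hU h₃).cmProd F Θ) = (cmProdAV F h₃ n Θ).X :=
    scheme_cmProd_universeOf hHD hI hU h₃ F n Θ
  have hdim : (cmProdAV F h₃ n Θ).dim = PicardCM.Var.dim ((universeOf hHD hI hU h₃).cmProd F Θ) := by
    rw [AbelianVariety.dim, ← hX]
    exact schemeDim_eq_holds (PicardCM.Var.isSmoothProjective hU h₃ _)
  rw [universeOf_hc_iff_hodgeConjectureFor, hdim, ← hX]

/-! ## §2 `HC_CM ⟹ W_RK4` on the model -/

/-- **`HC_CM` makes every face Weil line of the model algebraic**: `W_F(P(f)) ≤ Hodge classes of `P(f)`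
(`Model.universeOf_fact_weilLine_hodge`, rfwf Lemma 1.2) and `P(f) = ∏_i A_{(F, f.corner i)}` is a complex abelian variety of
CM type (`isOfCMType_cmProdAV`), on which `HC_CM` gives `HodgeConjectureFor`, i.e. `U.HC` (§1).
[cite: Deligne1982HodgeCycles, §4–§5] [cite: Milne1999, §7 p. 72] -/
theorem weilFaceAlgebraic_of_hc_cm (hHD : exists_isReal_hodgeModel)
    (hI : hodgePQ_independent_of_hodgeModel) (hU : BallQuotientUniformisedDatum) (h₃ : CMAbelianVarietyRealised)
    (h : HC_CM) (F : CMField) (f : Face F) :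
    (universeOf hHD hI hU h₃).WeilFaceAlgebraic F f :=
  CyclotomicSlice.weilFaceAlgebraic_of_hc _ (universeOf_fact_weilLine_hodge hHD hI hU h₃) F f
    ((universeOf_hc_cmProd_iff_hodgeConjectureFor_cmProdAV hHD hI hU h₃ F 3 f.corner).2
      (hodgeConjectureFor_cmProdAV_of_hc_cm h h₃ 3 f.corner))

/-- **`HC_CM ⟹ U.W_RK4`** for every instance of the model universe. [cite: Deligne1982HodgeCycles, §4–§5] -/
theorem w_rk4_of_hc_cm (hHD : exists_isReal_hodgeModel)
    (hI : hodgePQ_independent_of_hodgeModel) (hU : BallQuotientUniformisedDatum) (h₃ : CMAbelianVarietyRealised)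
    (h : HC_CM) :
    (universeOf hHD hI hU h₃).W_RK4 :=
  fun F _ _ f => weilFaceAlgebraic_of_hc_cm hHD hI hU h₃ h F f

/-! ## §3 `W_RK4 ⟹ HC_CM` from the model -/

/-- **Face reduction + exhaustion**: if every face Weil line of the model universe is algebraic (`U.W_RK4`), then for
every Galois CM field `F` with `6 ≤ [F:ℚ]` and every family `Θ`, `HodgeConjectureFor (cmProdAV F h₃ n Θ)` (Pohlmann's span
theorem + [QW8] Thm 2.5 on the model, `Model.hc_cmProd_of_weilFaceAlgebraic_of_riemann`, at the tree theorem
`deligneMilne1982_Thm_6_20_full_holds`; then §1). [cite: Pohlmann1968, Thm. 1] [cite: Milne2020HodgeClassesAV, Theorem 1] -/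
theorem hodgeConjectureFor_cmProdAV_of_w_rk4 (hHD : exists_isReal_hodgeModel)
    (hI : hodgePQ_independent_of_hodgeModel) (hU : BallQuotientUniformisedDatum) (h₃ : CMAbelianVarietyRealised)
    (hW : (universeOf hHD hI hU h₃).W_RK4)
    {F : Type} [Field F] [NumberField F] [IsCMField F] (hG : IsGalois ℚ F) (h6 : 6 ≤ Module.finrank ℚ F)
    (n : ℕ) (Θ : Fin (n + 1) → CMType F) : HodgeConjectureFor (cmProdAV F h₃ n Θ).dim (cmProdAV F h₃ n Θ).X :=
  (universeOf_hc_cmProd_iff_hodgeConjectureFor_cmProdAV hHD hI hU h₃ (CMField.mk F) n Θ).1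
    (hc_cmProd_of_weilFaceAlgebraic_of_riemann hHD hI hU h₃ (CMField.mk F) deligneMilne1982_Thm_6_20_full_holds hG h6
      (hW (CMField.mk F) hG h6) Θ)

/-- **`U.W_RK4 ⟹ HC_CM`**: the Galois slices of degree `≥ 6` exhaust `HC_CM` (part 1,
`hc_cm_of_forall_galois_cmProdAV`). [cite: Milne2020HodgeClassesAV, proof of Theorem 1] [cite: Pohlmann1968, Thm. 1] -/
theorem hc_cm_of_w_rk4 (hHD : exists_isReal_hodgeModel)
    (hI : hodgePQ_independent_of_hodgeModel) (hU : BallQuotientUniformisedDatum) (h₃ : CMAbelianVarietyRealised)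
    (hW : (universeOf hHD hI hU h₃).W_RK4) : HC_CM :=
  hc_cm_of_forall_galois_cmProdAV h₃ fun _ _ _ _ hG h6 n Θ =>
    hodgeConjectureFor_cmProdAV_of_w_rk4 hHD hI hU h₃ hW hG h6 n Θ

/-! ## §4 The equivalence -/

/-- **`HC_CM ⟺ U.W_RK4`** for every instance `U = Model.universeOf hHD hI hU h₃` of the Picard–CM model universe: the Hodge
conjecture for complex abelian varieties of CM type holds if and only if, for every Galois CM field `F` with `[F:ℚ] ≥ 6` and
every rank-four face `(Φ; π, π′)` of `F`, the Weil `F`-line of `A_{Φ₁} × A_{Φ₂} × A_{Φ₃} × A_{Φ₄}` consists of algebraic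
classes.  Neither side is asserted. [cite: Pohlmann1968, Thm. 1] [cite: Andre1992HodgeCM, Théorème (pp. 4–5)]
[cite: Milne2020HodgeClassesAV, Theorem 1] -/
theorem hc_cm_iff_w_rk4 (hHD : exists_isReal_hodgeModel)
    (hI : hodgePQ_independent_of_hodgeModel) (hU : BallQuotientUniformisedDatum) (h₃ : CMAbelianVarietyRealised) :
    HC_CM ↔ (universeOf hHD hI hU h₃).W_RK4 :=
  ⟨w_rk4_of_hc_cm hHD hI hU h₃, hc_cm_of_w_rk4 hHD hI hU h₃⟩

/-- **`HC_CM ⟺ W_RK4` on the model universe OF RECORD `Model.picardCMUniverse hHD hI h₁ h₃`** (the universe of the E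
term `hc_cm_of_PerLFace`). [cite: Pohlmann1968, Thm. 1] [cite: Milne2020HodgeClassesAV, Theorem 1] -/
theorem hc_cm_iff_w_rk4_picardCMUniverse (hHD : exists_isReal_hodgeModel) (hI : hodgePQ_independent_of_hodgeModel)
    (h₁ : BallQuotientUniformised) (h₃ : CMAbelianVarietyRealised) :
    HC_CM ↔ (picardCMUniverse hHD hI h₁ h₃).W_RK4 :=
  hc_cm_iff_w_rk4 hHD hI (ballQuotientUniformisedDatum_of h₁) h₃

/-- **`HC_CM ⟺ W_RK4(model universe of record)`, NO HYPOTHESIS** — all four data of the model are tree theorems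
(`exists_isReal_hodgeModel_holds`, `hodgePQ_independent_of_hodgeModel_holds`, `BallQuotient.ballQuotientUniformised_holds`,
`cmAbelianVarietyRealised_holds`; the same instance as the closed display `hc_cm_closed_of_perLFace`).
[cite: Pohlmann1968, Thm. 1] [cite: Andre1992HodgeCM, Théorème (pp. 4–5)] [cite: Milne2020HodgeClassesAV, Theorem 1] -/
theorem hc_cm_iff_w_rk4_of_record :
    HC_CM ↔ (picardCMUniverse exists_isReal_hodgeModel_holds hodgePQ_independent_of_hodgeModel_holds
      BallQuotient.ballQuotientUniformised_holds cmAbelianVarietyRealised_holds).W_RK4 :=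
  hc_cm_iff_w_rk4_picardCMUniverse _ _ _ _

/-- **The E term's displayed leaf is sufficient for `W_RK4`**: `PerLFace` of the model universe of record implies its
`W_RK4` (through `HC_CM`: `hc_cm_closed_of_perLFace` and `hc_cm_iff_w_rk4_of_record`).
[cite: Milne2020HodgeClassesAV, Theorem 1] -/
theorem w_rk4_of_record_of_perLFace
    (hP : (picardCMUniverse exists_isReal_hodgeModel_holds hodgePQ_independent_of_hodgeModel_holds
      BallQuotient.ballQuotientUniformised_holds cmAbelianVarietyRealised_holds).PerLFace) :
    (picardCMUniverse exists_isReal_hodgeModel_holds hodgePQ_independent_of_hodgeModel_holds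
      BallQuotient.ballQuotientUniformised_holds cmAbelianVarietyRealised_holds).W_RK4 :=
  hc_cm_iff_w_rk4_of_record.1 (hc_cm_closed_of_perLFace hP)

/-- **`HC_CM ⟺` every face Weil line algebraic AND every binder-language slice** — the two exhaustions side by
side, at the model universe of record: `W_RK4` (codimension-`2` Weil lines on fourfold corner products… of dimension
`2[F:ℚ]`) ⟺ the slices `∀ F n Θ, HodgeConjectureFor (∏_j A_{(F,Θ_j)})`. [cite: Pohlmann1968, Thm. 1]
[cite: Milne2020HodgeClassesAV, Theorem 1] -/
theorem w_rk4_of_record_iff_forall_galois_cmProdAV :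
    (picardCMUniverse exists_isReal_hodgeModel_holds hodgePQ_independent_of_hodgeModel_holds
      BallQuotient.ballQuotientUniformised_holds cmAbelianVarietyRealised_holds).W_RK4 ↔
    ∀ (F : Type) [Field F] [NumberField F] [IsCMField F], IsGalois ℚ F → 6 ≤ Module.finrank ℚ F →
      ∀ (n : ℕ) (Θ : Fin (n + 1) → CMType F),
        HodgeConjectureFor (cmProdAV F cmAbelianVarietyRealised_holds n Θ).dim
          (cmProdAV F cmAbelianVarietyRealised_holds n Θ).X :=
  hc_cm_iff_w_rk4_of_record.symm.trans (hc_cm_iff_forall_galois_cmProdAV cmAbelianVarietyRealised_holds)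

end Summit.HodgeConjecture.CorCM.SliceExhaustion

end
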